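import Summits.QuantumFields.QCD.Theorems.QuarksAsStableActionStableActionBridgeStubTwistedTraceComparison
import Summits.QuantumFields.QCD.Theorems.QuarksAsStableActionStableActionBridgeStubThermalTraceAntitone

/-!
# Twisted thermal expectations versus vacuum expectations (transfer-data form)
(crux `QuarksAsStableAction.StableActionBridge`, item stmt-QuantumFields-9737, line `Sketch`; lead helper,
`--supports stmt-QuantumFields-9737`, registered sub-goal `twisted_expectation_sub_vacuum_le`)

The NORMALISED form of the landed atom `stub_twistedTraceComparison` (card `twisted-trace-transfer`): for transfer
data `(T, Ω)` on a finite-dimensional Hilbert space, a contraction `Γ` fixing `Ω` (e.g. `(−1)^F`) and a bounded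
insertion `O`, the twisted thermal expectation `Tr(Γ O T^L)/Tr(Γ T^L)` differs from the vacuum expectation
`⟨Ω, O Ω⟩` by at most `2‖O‖ ε/(1 − ε)`, where `ε := Re Tr T^L − 1` is the THERMAL SMALLNESS of the untwisted
(antiperiodic) family, assumed `< 1`.  This is the one-axis step of the transfer: a boundary-condition flip costs an
additive error controlled by the low-temperature entropy sum, and in particular the twisted normaliser does not
vanish (`‖Tr(Γ T^L) − 1‖ ≤ ε < 1`).  Proof: the atom with `O` and with `O = 1`, then
`(t + a)/(1 + b) − t = (a − b t)/(1 + b)` with `‖a‖ ≤ ‖O‖ε`, `‖b‖ ≤ ε`, `‖t‖ ≤ ‖O‖`.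

## Appended (continuation lead c1): transfer across extents

For `L₀ ≤ L` the twisted expectation at extent `L` is controlled by the thermal smallness `ε_{L₀}` of the SMALLER
extent (`stub_thermalTraceAntitone`, p103305: `L ↦ Re Tr T^L` is non-increasing; `x ↦ x/(1−x)` is monotone on
`(−∞, 1)`): thermal smallness established at an EVEN extent `2S` — where A = `UnquenchedChessboardBound` is typed —
controls the statement's ODD extent `2S+1` and every larger one (`twisted_expectation_sub_vacuum_le_of_le`).
-/

namespace Summit.QuantumFields.QCD.Cruxes.StableActionBridge.Sketch

open scoped InnerProductSpace
open Literature.Probability.LatticeModels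

/-- **Twisted expectation vs vacuum expectation.**  For transfer data `D = (T, Ω)` on a finite-dimensional
Hilbert space, a contraction `Γ` with `Γ Ω = Ω`, a bounded `O`, and `ε := Re Tr T^L − 1 < 1`:
`‖Tr(Γ O T^L)/Tr(Γ T^L) − ⟨Ω, O Ω⟩‖ ≤ 2 ‖O‖ ε / (1 − ε)`. -/
theorem twisted_expectation_sub_vacuum_le :
    ∀ (H : Type) [NormedAddCommGroup H] [InnerProductSpace ℂ H] [CompleteSpace H]
      [FiniteDimensional ℂ H] (D : TransferData H) (Γ O : H →L[ℂ] H),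
      ‖Γ‖ ≤ 1 → Γ D.vacuum = D.vacuum → ∀ L : ℕ,
        (LinearMap.trace ℂ H ((D.T ^ L : H →L[ℂ] H) : H →ₗ[ℂ] H)).re - 1 < 1 →
          ‖LinearMap.trace ℂ H ((Γ * O * D.T ^ L : H →L[ℂ] H) : H →ₗ[ℂ] H) /
                LinearMap.trace ℂ H ((Γ * D.T ^ L : H →L[ℂ] H) : H →ₗ[ℂ] H) -
              ⟪D.vacuum, O D.vacuum⟫_ℂ‖ ≤
            2 * ‖O‖ * ((LinearMap.trace ℂ H ((D.T ^ L : H →L[ℂ] H) : H →ₗ[ℂ] H)).re - 1) /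
              (1 - ((LinearMap.trace ℂ H ((D.T ^ L : H →L[ℂ] H) : H →ₗ[ℂ] H)).re - 1)) := by
  intro H _ _ _ _ D Γ O hΓ hΓΩ L hε
  set ε : ℝ := (LinearMap.trace ℂ H ((D.T ^ L : H →L[ℂ] H) : H →ₗ[ℂ] H)).re - 1 with hε_def
  set t : ℂ := ⟪D.vacuum, O D.vacuum⟫_ℂ with ht
  set a : ℂ := LinearMap.trace ℂ H ((Γ * O * D.T ^ L : H →L[ℂ] H) : H →ₗ[ℂ] H) - t with ha
  set b : ℂ := LinearMap.trace ℂ H ((Γ * D.T ^ L : H →L[ℂ] H) : H →ₗ[ℂ] H) - 1 with hb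
  -- `H` is non-trivial since it carries a unit vector
  haveI : Nontrivial H := by
    refine ⟨⟨D.vacuum, 0, fun h0 => ?_⟩⟩
    have h1 := D.norm_vacuum
    rw [h0, norm_zero] at h1
    exact zero_ne_one h1
  -- the atom, with `O` and with `O = 1`
  have ha_le : ‖a‖ ≤ ‖O‖ * ε := stub_twistedTraceComparison H D Γ O hΓ hΓΩ L
  have hb_le : ‖b‖ ≤ ε := by
    have h := stub_twistedTraceComparison H D Γ 1 hΓ hΓΩ L
    have hid : ‖(1 : H →L[ℂ] H)‖ = 1 := by
      rw [ContinuousLinearMap.one_def]; exact ContinuousLinearMap.norm_id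
    rw [hid, one_mul] at h
    rw [hb, hε_def]
    simpa [inner_self_eq_norm_sq_to_K, D.norm_vacuum] using h
  have ht_le : ‖t‖ ≤ ‖O‖ := by
    calc ‖t‖ ≤ ‖D.vacuum‖ * ‖O D.vacuum‖ := norm_inner_le_norm _ _
      _ ≤ ‖D.vacuum‖ * (‖O‖ * ‖D.vacuum‖) :=
          mul_le_mul_of_nonneg_left (O.le_opNorm _) (norm_nonneg _)
      _ = ‖O‖ := by rw [D.norm_vacuum]; ring
  -- algebra
  have hε0 : 0 ≤ ε := (norm_nonneg b).trans hb_le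
  have hr1 : 0 < 1 - ε := by linarith
  have h1b : 1 - ε ≤ ‖1 + b‖ := by
    have h2 := norm_sub_norm_le (1 : ℂ) (-b)
    rw [norm_one, norm_neg, sub_neg_eq_add] at h2
    linarith
  have h1b_pos : 0 < ‖1 + b‖ := lt_of_lt_of_le hr1 h1b
  have h1b_ne : (1 + b) ≠ 0 := norm_pos_iff.1 h1b_pos
  have hnum : LinearMap.trace ℂ H ((Γ * O * D.T ^ L : H →L[ℂ] H) : H →ₗ[ℂ] H) = t + a := by
    rw [ha]; ring
  have hden : LinearMap.trace ℂ H ((Γ * D.T ^ L : H →L[ℂ] H) : H →ₗ[ℂ] H) = 1 + b := by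
    rw [hb]; ring
  rw [hnum, hden]
  have hrewrite : (t + a) / (1 + b) - t = (a - b * t) / (1 + b) := by
    field_simp
    ring
  rw [hrewrite, norm_div, div_le_div_iff₀ h1b_pos hr1]
  have hnum_le : ‖a - b * t‖ ≤ ‖O‖ * ε + ε * ‖O‖ := by
    refine (norm_sub_le _ _).trans (add_le_add ha_le ?_)
    rw [norm_mul]
    exact mul_le_mul hb_le ht_le (norm_nonneg _) hε0
  calc ‖a - b * t‖ * (1 - ε) ≤ (‖O‖ * ε + ε * ‖O‖) * (1 - ε) :=
        mul_le_mul_of_nonneg_right hnum_le hr1.le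
    _ = 2 * ‖O‖ * ε * (1 - ε) := by ring
    _ ≤ 2 * ‖O‖ * ε * ‖1 + b‖ := by
        refine mul_le_mul_of_nonneg_left h1b ?_
        positivity

/-! ## Transfer across extents (appended) -/

/-- `x ↦ x / (1 - x)` is monotone on `(-∞, 1)`. -/
private theorem div_one_sub_mono {x y : ℝ} (hxy : x ≤ y) (hy : y < 1) : x / (1 - x) ≤ y / (1 - y) := by
  have hx : x < 1 := lt_of_le_of_lt hxy hy
  rw [div_le_div_iff₀ (by linarith) (by linarith)]
  nlinarith

/-- **Twisted-trace transfer across extents.**  For transfer data `(T, Ω)` on a finite-dimensional Hilbert space,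
a contraction `Γ` fixing `Ω`, a bounded insertion `O` and extents `L₀ ≤ L`: if the thermal smallness at the
SMALLER extent satisfies `ε_{L₀} = Re Tr T^{L₀} − 1 < 1`, then
`‖Tr(Γ O T^L)/Tr(Γ T^L) − ⟨Ω, OΩ⟩‖ ≤ 2‖O‖ ε_{L₀}/(1 − ε_{L₀})` — the twisted (e.g. `(−1)^F`-periodic, odd-extent)
expectation is within the EVEN/smaller-extent thermal error of the vacuum expectation. [folklore] -/
theorem twisted_expectation_sub_vacuum_le_of_le :
    ∀ (H : Type) [NormedAddCommGroup H] [InnerProductSpace ℂ H] [CompleteSpace H]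
      [FiniteDimensional ℂ H] (D : TransferData H) (Γ O : H →L[ℂ] H),
      ‖Γ‖ ≤ 1 → Γ D.vacuum = D.vacuum → ∀ L₀ L : ℕ, L₀ ≤ L →
        (LinearMap.trace ℂ H ((D.T ^ L₀ : H →L[ℂ] H) : H →ₗ[ℂ] H)).re - 1 < 1 →
          ‖LinearMap.trace ℂ H ((Γ * O * D.T ^ L : H →L[ℂ] H) : H →ₗ[ℂ] H) /
                LinearMap.trace ℂ H ((Γ * D.T ^ L : H →L[ℂ] H) : H →ₗ[ℂ] H) -
              ⟪D.vacuum, O D.vacuum⟫_ℂ‖ ≤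
            2 * ‖O‖ * ((LinearMap.trace ℂ H ((D.T ^ L₀ : H →L[ℂ] H) : H →ₗ[ℂ] H)).re - 1) /
              (1 - ((LinearMap.trace ℂ H ((D.T ^ L₀ : H →L[ℂ] H) : H →ₗ[ℂ] H)).re - 1)) := by
  intro H _ _ _ _ D Γ O hΓ hΓΩ L₀ L hL hε₀
  have hanti := stub_thermalTraceAntitone H D hL
  simp only at hanti
  have hεle : (LinearMap.trace ℂ H ((D.T ^ L : H →L[ℂ] H) : H →ₗ[ℂ] H)).re - 1 ≤
      (LinearMap.trace ℂ H ((D.T ^ L₀ : H →L[ℂ] H) : H →ₗ[ℂ] H)).re - 1 := by linarith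
  have hεL : (LinearMap.trace ℂ H ((D.T ^ L : H →L[ℂ] H) : H →ₗ[ℂ] H)).re - 1 < 1 := lt_of_le_of_lt hεle hε₀
  refine (twisted_expectation_sub_vacuum_le H D Γ O hΓ hΓΩ L hεL).trans ?_
  rw [mul_div_assoc, mul_div_assoc]
  exact mul_le_mul_of_nonneg_left (div_one_sub_mono hεle hε₀) (by positivity)

end Summit.QuantumFields.QCD.Cruxes.StableActionBridge.Sketch
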